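import Literature.Topology.FourManifolds.ClosedModelPieces
import Literature.Topology.FourManifolds.TopCohomologyClosedComponent
import Literature.AlgebraicTopology.SingularHomology.WuVanishingOfTube
import Literature.AlgebraicTopology.SingularHomology.CohomologyClopenPieces
import HarnessLib

/-!
# The Wu class of a closed connected component of a tubed manifold vanishes

Topic `Literature/Topology/FourManifolds`; proofs file of the fact seat of
`Literature.Topology.FourManifolds.HomotopySphere.exists_mem_signatureSet_iff_eight_dvd`
(M. Kervaire, J. Milnor, *Groups of homotopy spheres I*, Ann. of Math. 77 (1963), §7, p. 530),
for the evenness of the intersection form of a DISCONNECTED s-parallelizable null-cobordism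
(`HomotopySphere.eight_dvd_of_mem_signatureSet_of_isEven`; Kosinski, *Differential Manifolds*
(1993), X.(3.1); the Wu-class route of Milnor–Stasheff, *Characteristic classes* (1974), §18
with Thm. 11.14).

Let `W` be a compact smooth `(n+1)`-manifold with boundary carrying a closed tube
`t : W × [0,1]ᴺ ↪ 𝕊ⁿ⁺¹⁺ᴺ` whose open part over the interior `W°` is open
(`FramedTube.exists_closedTube` for `W` s-parallelizable), and let `V ⊆ W` be open, closed,
connected and contained in `W°` — a closed connected component of `W`. Then
**`Sq : Hᵏ(↥V°; ℤ/2) → Hⁿ⁺¹(↥V°; ℤ/2)` vanishes** (`k + k = n + 1`) on the copy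
`V° = {x ∈ W° | x ∈ V}` of `V` inside the closed model `Ŵ = W ∪ cone(∂W)`
(`steenrodSqLower_image_coe_eq_zero_of_tube`). Proof:

1. the tube restricts to a tube of the compact space `↥V` whose open part
   `t (V × (0,1)ᴺ) = t (W° × (0,1)ᴺ) ∖ t ((W ∖ V) × [0,1]ᴺ)` is open (`image_restrict_tube_eq`);
2. `steenrodSqLower_eq_zero_of_tube` (`WuVanishingOfTube.lean`) on the pair `(↥V, V ∩ W°)` gives
   `Sq = 0` on `(V ∩ W°)⁺`, granted that `Hⁿ⁺¹((V ∩ W°)⁺; ℤ/2)` has a single nonzero element;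
3. `(V ∩ W°)⁺ ≃ₜ {∞} ∪ V° ⊆ Ŵ` (`ClosedModel.nonempty_onePoint_homeomorph_insert_image_coe`), in
   which `V°` and `{∞}` are disjoint open pieces: restriction `Hⁿ⁺¹({∞} ∪ V°) → Hⁿ⁺¹(V°)` is
   injective (`map_subsetIncl_injective_of_clopen`, `Hⁿ⁺¹(pt) = 0`) and `Hⁿ⁺¹(V°; ℤ/2)` has a
   single nonzero element (`eq_of_ne_zero_singularCohomology_image_coe_top`, Hatcher 3.26(a) on
   the closed connected manifold `V`) — which gives the grant in (2) — and every class of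
   `Hᵏ(V°)` extends to `{∞} ∪ V°` (`steenrodSqLower_eq_zero_subsetIncl_of_clopen`), which brings
   `Sq = 0` down to `V°`.

Everything is proved; no definition, no named fact (D-0026).

## References

* J. Milnor, J. Stasheff, *Characteristic classes*, Princeton UP 1974, §18, Thm. 11.14.
  [MilnorStasheff1974]
* A. Kosinski, *Differential Manifolds*, Academic Press 1993, Ch. X Prop. (3.1). [Kosinski1993]
* A. Hatcher, *Algebraic Topology*, CUP 2002, §3.1 pp. 203–204, Thm. 3.26(a). [HatcherAT2002]
* M. Kervaire, J. Milnor, *Groups of homotopy spheres I*, Ann. of Math. 77 (1963), §7.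
  [KervaireMilnorAnnals1963]
-/

open scoped Manifold ContDiff Topology
open Set Function CategoryTheory CategoryTheory.Limits
open Literature.AlgebraicTopology.SingularHomology Literature.AlgebraicTopology.Homotopy

noncomputable section

namespace Literature.Topology.FourManifolds

section ClosedPiece

variable {n : ℕ} {W : Type} [TopologicalSpace W] [T2Space W] [CompactSpace W]
  [ChartedSpace (EuclideanHalfSpace (n + 1)) W] [IsManifold (𝓡∂ (n + 1)) ∞ W]

omit [TopologicalSpace W] [T2Space W] [CompactSpace W] [ChartedSpace (EuclideanHalfSpace (n + 1)) W]
  [IsManifold (𝓡∂ (n + 1)) ∞ W] in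
/-- **The open part of the restricted tube**: for `t` injective, `V ⊆ W` and `X ⊆ W`,
`t ((V ∩ X) × C) = t (X × C) ∖ t ((W ∖ V) × [0,1]ᴺ)`, written for the restriction of `t` to
`↥V × [0,1]ᴺ`. [folklore] -/
theorem image_restrict_tube_eq {S : Type*} {N : ℕ} (t : W × (Fin N → unitInterval) → S) (hinj : Injective t)
    (V X : Set W) (C : Set (Fin N → unitInterval)) :
    (fun p : ↥V × (Fin N → unitInterval) => t (p.1.1, p.2)) '' ((Subtype.val ⁻¹' X) ×ˢ C) =
      t '' (X ×ˢ C) \ t '' (Vᶜ ×ˢ univ) := by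
  ext s
  constructor
  · rintro ⟨⟨a, θ⟩, ⟨ha, hθ⟩, rfl⟩
    refine ⟨⟨(a.1, θ), ⟨ha, hθ⟩, rfl⟩, ?_⟩
    rintro ⟨⟨w, θ'⟩, ⟨hw, -⟩, h⟩
    have h' := hinj h
    simp only [Prod.mk.injEq] at h'
    exact hw (h'.1 ▸ a.2)
  · rintro ⟨⟨⟨w, θ⟩, ⟨hw, hθ⟩, rfl⟩, hs⟩
    have hwV : w ∈ V := by
      by_contra hwV
      exact hs ⟨(w, θ), ⟨hwV, mem_univ _⟩, rfl⟩
    exact ⟨(⟨w, hwV⟩, θ), ⟨hw, hθ⟩, rfl⟩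

/-- **The Wu class of a closed connected component of a tubed manifold vanishes**
(Milnor–Stasheff §18 with Thm. 11.14; Kosinski X.(3.1)): for `V ⊆ W` open, closed, connected,
contained in `W°`, a closed tube `t` of `W` in `𝕊ⁿ⁺¹⁺ᴺ` with open part over `W°` open, and
`k + k = n + 1`, `Sq : Hᵏ(↥V°; ℤ/2) → Hⁿ⁺¹(↥V°; ℤ/2)` is zero on `V° = {x ∈ W° | x ∈ V} ⊆ Ŵ`.
See the module docstring. [cite: MilnorStasheff1974, §18 pp. 215–216 and Thm. 11.14] [cite: Kosinski1993, Ch. X, Prop. (3.1) (p. 205)] -/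
theorem steenrodSqLower_image_coe_eq_zero_of_tube (V : TopologicalSpace.Opens W)
    (hVcl : IsClosed (V : Set W)) (hVint : (V : Set W) ⊆ (𝓡∂ (n + 1)).interior W)
    (hVconn : IsConnected (V : Set W)) {k : ℕ} (hk : k + k = n + 1) {N : ℕ}
    (t : W × (Fin N → unitInterval) → Metric.sphere (0 : EuclideanSpace ℝ (Fin (n + 1 + N + 1))) 1)
    (ht : Continuous t) (hinj : Injective t)
    (hTo : IsOpen (t '' ((𝓡∂ (n + 1)).interior W ×ˢ (Set.pi univ fun _ : Fin N => Susp.midHeights))))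
    (y : singularCohomology (ZMod 2) (ZMod 2)
      (↥((ClosedModel.ofInterior : ManifoldInterior n W → ClosedModel n W) ''
        {x | x.1 ∈ (V : Set W)})) k) :
    steenrodSqLower
      (↥((ClosedModel.ofInterior : ManifoldInterior n W → ClosedModel n W) ''
        {x | x.1 ∈ (V : Set W)})) k (n + 1) 0 y = 0 := by
  haveI : Fact (Nat.Prime 2) := ⟨Nat.prime_two⟩
  -- notation: `V° ⊆ Ŵ`, `Y = {∞} ∪ V°`, the compact space `↥V` and its tubed open part `X`
  revert y
  set Vo : Set (ClosedModel n W) :=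
    (ClosedModel.ofInterior : ManifoldInterior n W → ClosedModel n W) '' {x | x.1 ∈ (V : Set W)}
    with hVo
  intro y
  set Yset : Set (ClosedModel n W) := insert (ClosedModel.infty : ClosedModel n W) Vo with hYset
  haveI : CompactSpace (V : Type) := isCompact_iff_compactSpace.1 hVcl.isCompact
  set X : Set (V : Type) := (Subtype.val : ↥V → W) ⁻¹' (𝓡∂ (n + 1)).interior W with hX
  have hXo : IsOpen X :=
    (InteriorManifold.isOpen_interior_carrier (I := 𝓡∂ (n + 1)) (M := W)).preimage
      continuous_subtype_val
  obtain ⟨w₀, hw₀⟩ := hVconn.nonempty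
  have hXne : X.Nonempty := ⟨⟨w₀, hw₀⟩, hVint hw₀⟩
  -- (1) the restricted tube
  let tV : (↥V) × (Fin N → unitInterval) → Metric.sphere (0 : EuclideanSpace ℝ (Fin (n + 1 + N + 1))) 1 :=
    fun p => t (p.1.1, p.2)
  have htV : Continuous tV :=
    ht.comp ((continuous_subtype_val.comp continuous_fst).prodMk continuous_snd)
  have hinjV : Injective tV := by
    rintro ⟨a, θ⟩ ⟨a', θ'⟩ h
    have h' := hinj h
    simp only [Prod.mk.injEq] at h'
    exact Prod.ext (Subtype.ext h'.1) h'.2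
  have hToV : IsOpen (tubeCollapse.openTube X tV) := by
    have hEq : tV '' (X ×ˢ tubeCollapse.openCube N) =
        t '' ((𝓡∂ (n + 1)).interior W ×ˢ tubeCollapse.openCube N) \ t '' ((V : Set W)ᶜ ×ˢ univ) :=
      image_restrict_tube_eq t hinj (V : Set W) ((𝓡∂ (n + 1)).interior W) (tubeCollapse.openCube N)
    change IsOpen (tV '' (X ×ˢ tubeCollapse.openCube N))
    rw [hEq]
    refine hTo.sdiff (IsCompact.isClosed ?_)
    exact ((V.isOpen.isClosed_compl.isCompact).prod isCompact_univ).image ht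
  -- (3a) the pieces `V°`, `{∞}` of `Y = {∞} ∪ V°`
  have hVo_open : IsOpen Vo := ClosedModel.isOpen_image_coe_of_isOpen V.isOpen
  have hVo_closed : IsClosed Vo := ClosedModel.isClosed_image_coe_of_isClosed hVcl hVint
  have hinfVo : (ClosedModel.infty : ClosedModel n W) ∉ Vo := OnePoint.infty_notMem_image_coe
  set A : Set ↥Yset := Subtype.val ⁻¹' Vo with hA
  set B : Set ↥Yset := Subtype.val ⁻¹' {ClosedModel.infty} with hB
  have hBeq : B = Subtype.val ⁻¹' Voᶜ := by
    ext z
    simp only [hB, mem_preimage, mem_singleton_iff, mem_compl_iff]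
    constructor
    · intro hz; rw [hz]; exact hinfVo
    · intro hz; exact (mem_insert_iff.1 z.2).resolve_right hz
  have hAo : IsOpen A := hVo_open.preimage continuous_subtype_val
  have hBo : IsOpen B := by rw [hBeq]; exact hVo_closed.isOpen_compl.preimage continuous_subtype_val
  have hU : A ∪ B = univ := by
    ext z
    simp only [hA, hB, mem_union, mem_preimage, mem_singleton_iff, mem_univ, iff_true]
    exact ((mem_insert_iff.1 z.2).symm)
  have hAB : A ∩ B = ∅ := by
    ext z
    simp only [hA, hB, mem_inter_iff, mem_preimage, mem_singleton_iff, mem_empty_iff_false,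
      iff_false, not_and]
    intro hz hz'; rw [hz'] at hz; exact hinfVo hz
  -- `Hⁿ⁺¹(↥B) = 0`: `↥B` is a point
  haveI : Subsingleton ↥B :=
    ⟨fun z z' => Subtype.ext (Subtype.ext ((show (z : ↥Yset).1 = ClosedModel.infty from z.2).trans
      (show (z' : ↥Yset).1 = ClosedModel.infty from z'.2).symm))⟩
  have hBZ : IsZero (singularCohomology (ZMod 2) (ZMod 2) (↥B) (n + 1)) :=
    singularCochainComplex.isZero_singularCohomology_of_subsingleton' (R := ZMod 2) (M := ZMod 2)
      (Nat.succ_ne_zero n)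
  have hr : Injective (singularCohomology.map (ZMod 2) (ZMod 2) (subsetIncl A) (n + 1)) :=
    map_subsetIncl_injective_of_clopen hAo hBo hU hAB hBZ
  -- `↥A ≃ₜ ↥V°`
  let θ : ↥A ≃ₜ ↥Vo :=
    { toFun := fun z => ⟨z.1.1, z.2⟩
      invFun := fun w => ⟨⟨w.1, mem_insert_of_mem _ w.2⟩, w.2⟩
      left_inv := fun z => Subtype.ext (Subtype.ext rfl)
      right_inv := fun w => Subtype.ext rfl
      continuous_toFun := Continuous.subtype_mk (continuous_subtype_val.comp continuous_subtype_val) _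
      continuous_invFun :=
        Continuous.subtype_mk (Continuous.subtype_mk continuous_subtype_val _) _ }
  -- (3b) one nonzero class in the top degree, on `V°`, `↥A`, `Y`, `X⁺`
  have hVo1 : ∀ a b : singularCohomology (ZMod 2) (ZMod 2) (↥Vo) (n + 1), a ≠ 0 → b ≠ 0 → a = b :=
    fun a b ha hb => eq_of_ne_zero_singularCohomology_image_coe_top V hVcl hVint hVconn ha hb
  have hA1 : ∀ a b : singularCohomology (ZMod 2) (ZMod 2) (↥A) (n + 1), a ≠ 0 → b ≠ 0 → a = b :=
    fun a b ha hb => eq_of_ne_zero_of_homeomorph θ.symm hVo1 ha hb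
  have hY1 : ∀ a b : singularCohomology (ZMod 2) (ZMod 2) (↥Yset) (n + 1), a ≠ 0 → b ≠ 0 → a = b :=
    fun a b ha hb => eq_of_ne_zero_of_injective
      (fun c => singularCohomology.map (ZMod 2) (ZMod 2) (subsetIncl A) (n + 1) c) hr (map_zero _)
      hA1 ha hb
  obtain ⟨e⟩ := ClosedModel.nonempty_onePoint_homeomorph_insert_image_coe (n := n) (W := W)
    (V := (V : Set W)) hVcl
  have hX1 : ∀ a b : singularCohomology (ZMod 2) (ZMod 2) (OnePoint ↥X) (n + 1),
      a ≠ 0 → b ≠ 0 → a = b :=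
    fun a b ha hb => eq_of_ne_zero_of_homeomorph e.symm hY1 ha hb
  -- (2) the tube argument on `(↥V, X)`
  have hSqX : ∀ y' : singularCohomology (ZMod 2) (ZMod 2) (OnePoint ↥X) k,
      steenrodSqLower (OnePoint ↥X) k (n + 1) 0 y' = 0 := fun y' =>
    steenrodSqLower_eq_zero_of_tube (P := (V : Type)) (X := X) hXo hXne hk hX1 rfl tV htV hinjV
      hToV y'
  -- (3c) transport `Sq = 0` to `Y`, to `↥A` and to `V°`
  have hSqY : ∀ z : singularCohomology (ZMod 2) (ZMod 2) (↥Yset) k,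
      steenrodSqLower (↥Yset) k (n + 1) 0 z = 0 :=
    steenrodSqLower_eq_zero_of_homeomorph e hSqX
  have hSqA : ∀ a : singularCohomology (ZMod 2) (ZMod 2) (↥A) k,
      steenrodSqLower (↥A) k (n + 1) 0 a = 0 :=
    steenrodSqLower_eq_zero_subsetIncl_of_clopen hAo hBo hU hAB hSqY
  exact steenrodSqLower_eq_zero_of_homeomorph θ hSqA y

end ClosedPiece

end Literature.Topology.FourManifolds
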